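import Mathlib.Topology.Connected.PathConnected
import Literature.Topology.PlaneTopology.Schoenflies
import Literature.Topology.PlaneTopology.JordanNesting
import HarnessLib

/-!
# The closure of a Jordan domain is uniformly locally path-connected; loops around a boundary point

Topic: Topology / PlaneTopology.  Elementary plane topology of the CLOSURE `closure Ω` of a Jordan
domain `Ω` (`Literature.Probability.RandomPlanarGeometry.JordanDomain`) and of Jordan loops
(`IsJordanLoop`, `JordanSweepParity.lean`) surrounding one of its boundary points, as needed by
continuum crossing/separation arguments for percolation in general Jordan domains
(Bollobás–Riordan, *Percolation* (2006), Ch. 7, proof of Claim 22, p. 198; Smirnov's theorem in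
conformal rectangles):

* `exists_schoenflies` — the Schoenflies theorem packaged (`JordanDomain.DiscChart.exists_homeomorph_eqOn`,
  Pommerenke, *Boundary behaviour of conformal maps* (1992), §2.3 Cor. 2.8): a homeomorphism of
  `ℂ` carrying `𝔻`, `∂𝔻`, `𝔻̄` onto `Ω`, `∂Ω`, `closure Ω`;
* `exists_joinedIn_closure_ball` — **uniform local path-connectedness of `closure Ω`**: for
  `ε > 0` there is `η > 0` such that points of `closure Ω` at distance `< η` are joined by a path
  in `closure Ω ∩ B(z, ε)` (pull back to the closed disc, which is convex, by uniform continuity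
  of the Schoenflies homeomorphism and of its inverse on the two compacta).  The tree's
  `JordanDomain.uniformlyLocallyConnected` (`UniformLocalConnectedness.lean`, Newman VI.14·1) is
  the statement for the OPEN domain with connected sets; here we need the closed domain and paths;
* `exists_pos_forall_le_dist` (disjoint compact/closed sets are at positive distance),
  `exists_trimmed_interval` (first-entrance/last-exit trimming of a parameter interval between two
  closed sets), `isPreconnected_annulus` (closed round annuli are connected);
* `exists_param_not_mem_closure` — a Jordan loop with a boundary point of `Ω` in its inside leaves
  `closure Ω`; `mem_outside_of_lt_dist` — points farther from `p` than the whole loop are outside;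
* `exists_path_range_eq_image` (the arc `Γ|[u, v]` as a `Path`), `exists_subpath` (a sub-path of
  a path between two of its times, in either order).

All statements are folklore; no measure theory and no percolation here.

## References
* Ch. Pommerenke, *Boundary Behaviour of Conformal Maps*, Springer (1992), §2.3 Cor. 2.8. [PommerenkeBBCM1992]
* B. Bollobás, O. Riordan, *Percolation*, CUP (2006), Ch. 7 p. 198. [BollobasRiordan2006]
-/

namespace Literature.Topology.PlaneTopology

open Set Metric Filter Function _root_.Topology
open Literature.Probability.RandomPlanarGeometry

/-! ### Schoenflies and uniform local path-connectedness of `closure Ω` -/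

/-- Schoenflies, packaged: a homeomorphism of `ℂ` carrying the open disc, the circle and the
closed disc onto `Ω`, `∂Ω`, `closure Ω`. [cite: PommerenkeBBCM1992, §2.3 Cor. 2.8] -/
theorem exists_schoenflies (D : JordanDomain) :
    ∃ H : ℂ ≃ₜ ℂ, H '' ball 0 1 = D.carrier ∧ H '' sphere 0 1 = frontier D.carrier ∧
      H '' closedBall 0 1 = closure D.carrier := by
  obtain ⟨z, hz⟩ := D.nonempty
  obtain ⟨C, -⟩ := D.exists_discChart_apply_eq hz
  obtain ⟨H, -, h1, h2, h3, -⟩ := C.exists_homeomorph_eqOn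
  exact ⟨H, h1, h2, h3⟩

/-- **Uniform local path-connectedness of `closure Ω`** (a closed disc, by Schoenflies): for
`ε > 0` there is `η > 0` such that two points of `closure Ω` at distance `< η` are joined by a
path in `closure Ω` staying within distance `< ε` of the first point. [folklore] -/
theorem exists_joinedIn_closure_ball (D : JordanDomain) {ε : ℝ} (hε : 0 < ε) :
    ∃ η > 0, ∀ z ∈ closure D.carrier, ∀ z' ∈ closure D.carrier, dist z z' < η →
      JoinedIn (closure D.carrier ∩ ball z ε) z z' := by
  obtain ⟨H, -, -, hcl⟩ := exists_schoenflies D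
  -- uniform continuity of `H` on the closed disc and of `H.symm` on `closure Ω`
  have hK : IsCompact (closedBall (0 : ℂ) 1) := isCompact_closedBall 0 1
  have hHuc : UniformContinuousOn H (closedBall (0 : ℂ) 1) :=
    hK.uniformContinuousOn_of_continuous H.continuous.continuousOn
  have hcl_c : IsCompact (closure D.carrier) := by rw [← hcl]; exact hK.image H.continuous
  have hSuc : UniformContinuousOn H.symm (closure D.carrier) :=
    hcl_c.uniformContinuousOn_of_continuous H.symm.continuous.continuousOn
  rw [Metric.uniformContinuousOn_iff] at hHuc hSuc
  obtain ⟨θ, hθ, hθH⟩ := hHuc ε hε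
  obtain ⟨η, hη, hηS⟩ := hSuc θ hθ
  refine ⟨η, hη, fun z hz z' hz' hzz' => ?_⟩
  -- preimages in the closed disc
  have hmem : ∀ w ∈ closure D.carrier, H.symm w ∈ closedBall (0 : ℂ) 1 := fun w hw => by
    rw [← hcl] at hw
    obtain ⟨u, hu, rfl⟩ := hw
    rwa [H.symm_apply_apply]
  set a := H.symm z with ha
  set b := H.symm z' with hb
  have haB : a ∈ closedBall (0 : ℂ) 1 := hmem z hz
  have hbB : b ∈ closedBall (0 : ℂ) 1 := hmem z' hz'
  have hab : dist a b < θ := hηS z hz z' hz' hzz'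
  -- the image of the segment `[a, b]`
  have hseg : segment ℝ a b ⊆ closedBall (0 : ℂ) 1 := (convex_closedBall 0 1).segment_subset haB hbB
  let γ : Path z z' := ((Path.segment a b).map H.continuous).cast
    (by simp [ha]) (by simp [hb])
  refine ⟨γ, fun t => ⟨?_, ?_⟩⟩
  · have hw : (Path.segment a b) t ∈ closedBall (0 : ℂ) 1 :=
      hseg (by rw [← Path.range_segment]; exact mem_range_self t)
    show H ((Path.segment a b) t) ∈ closure D.carrier
    rw [← hcl]
    exact mem_image_of_mem H hw
  · have hwt : (Path.segment a b) t ∈ closedBall (0 : ℂ) 1 :=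
      hseg (by rw [← Path.range_segment]; exact mem_range_self t)
    have hd : dist ((Path.segment a b) t) a < θ := by
      rw [Path.segment_apply]
      calc dist (AffineMap.lineMap a b (t : ℝ)) a = ‖(t : ℝ)‖ * dist a b :=
            dist_lineMap_left a b (t : ℝ)
        _ ≤ 1 * dist a b := by
            gcongr
            rw [Real.norm_eq_abs, abs_of_nonneg t.2.1]
            exact t.2.2
        _ < θ := by rw [one_mul]; exact hab
    show H ((Path.segment a b) t) ∈ ball z ε
    rw [mem_ball]
    have := hθH _ hwt a haB hd
    rwa [show H a = z by simp [ha]] at this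

/-! ### Distances of disjoint compacta, trimming, annuli -/

/-- Disjoint compact/closed sets are at positive distance. [folklore] -/
theorem exists_pos_forall_le_dist {A B : Set ℂ} (hA : IsCompact A) (hB : IsClosed B)
    (h : Disjoint A B) : ∃ d > 0, ∀ a ∈ A, ∀ b ∈ B, d ≤ dist a b := by
  obtain ⟨d, hd, hdis⟩ := h.exists_cthickenings hA hB
  refine ⟨d, hd, fun a ha b hb => ?_⟩
  by_contra hlt
  push Not at hlt
  have h1 : b ∈ cthickening d A := mem_cthickening_of_dist_le b a d A ha (by rw [dist_comm]; exact hlt.le)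
  have h2 : b ∈ cthickening d B := self_subset_cthickening B hb
  exact Set.disjoint_left.1 hdis h1 h2

/-- **Trimming.** If `Γ u ∈ 𝒜`, `Γ v ∈ ℬ` (`u < v`, `𝒜`, `ℬ` closed, `Γ` continuous) and no
parameter in `[u, v]` is mapped into `𝒜 ∩ ℬ`, then some sub-interval `[u₁, v₁] ⊆ [u, v]` has
`Γ u₁ ∈ 𝒜`, `Γ v₁ ∈ ℬ` and its interior mapped off `𝒜 ∪ ℬ`. [folklore] -/
theorem exists_trimmed_interval {Γ : ℝ → ℂ} (hΓ : Continuous Γ) {𝒜 ℬ : Set ℂ} (h𝒜 : IsClosed 𝒜)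
    (hℬ : IsClosed ℬ) {u v : ℝ} (huv : u < v) (hu : Γ u ∈ 𝒜) (hv : Γ v ∈ ℬ)
    (hdis : ∀ x ∈ Icc u v, Γ x ∈ 𝒜 → Γ x ∈ ℬ → False) :
    ∃ u₁ v₁ : ℝ, u ≤ u₁ ∧ u₁ < v₁ ∧ v₁ ≤ v ∧ Γ u₁ ∈ 𝒜 ∧ Γ v₁ ∈ ℬ ∧
      ∀ x ∈ Ioo u₁ v₁, Γ x ∉ 𝒜 ∧ Γ x ∉ ℬ := by
  -- first entrance into `ℬ`
  set Sv : Set ℝ := Icc u v ∩ Γ ⁻¹' ℬ with hSv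
  have hSvc : IsClosed Sv := isClosed_Icc.inter (hℬ.preimage hΓ)
  have hSvne : Sv.Nonempty := ⟨v, ⟨right_mem_Icc.2 huv.le, hv⟩⟩
  have hSvbdd : BddBelow Sv := ⟨u, fun x hx => hx.1.1⟩
  set v₁ := sInf Sv with hv₁
  have hv₁mem : v₁ ∈ Sv := hSvc.csInf_mem hSvne hSvbdd
  have huv₁ : u < v₁ := by
    rcases hv₁mem.1.1.lt_or_eq with h | h
    · exact h
    · exact (hdis u (left_mem_Icc.2 huv.le) hu (h ▸ hv₁mem.2)).elim
  -- last exit from `𝒜` before `v₁`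
  set Su : Set ℝ := Icc u v₁ ∩ Γ ⁻¹' 𝒜 with hSu
  have hSuc : IsClosed Su := isClosed_Icc.inter (h𝒜.preimage hΓ)
  have hSune : Su.Nonempty := ⟨u, ⟨left_mem_Icc.2 huv₁.le, hu⟩⟩
  have hSubdd : BddAbove Su := ⟨v₁, fun x hx => hx.1.2⟩
  set u₁ := sSup Su with hu₁
  have hu₁mem : u₁ ∈ Su := hSuc.csSup_mem hSune hSubdd
  have hu₁v₁ : u₁ < v₁ := by
    rcases hu₁mem.1.2.lt_or_eq with h | h
    · exact h
    · exact (hdis v₁ ⟨huv₁.le, hv₁mem.1.2⟩ (h ▸ hu₁mem.2) hv₁mem.2).elim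
  refine ⟨u₁, v₁, hu₁mem.1.1, hu₁v₁, hv₁mem.1.2, hu₁mem.2, hv₁mem.2, fun x hx => ⟨?_, ?_⟩⟩
  · intro hx𝒜
    have hxSu : x ∈ Su := ⟨⟨hu₁mem.1.1.trans hx.1.le, hx.2.le⟩, hx𝒜⟩
    exact (not_le.2 hx.1) (le_csSup hSubdd hxSu)
  · intro hxℬ
    have hxSv : x ∈ Sv := ⟨⟨(hu₁mem.1.1.trans hx.1.le), hx.2.le.trans hv₁mem.1.2⟩, hxℬ⟩
    exact (not_le.2 hx.2) (csInf_le hSvbdd hxSv)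

/-- A closed annulus `{a ≤ ‖w‖ ≤ b}` (`0 ≤ a`) is preconnected (polar coordinates). [folklore] -/
theorem isPreconnected_annulus {a b : ℝ} (ha : 0 ≤ a) :
    IsPreconnected {w : ℂ | a ≤ ‖w‖ ∧ ‖w‖ ≤ b} := by
  have himage : {w : ℂ | a ≤ ‖w‖ ∧ ‖w‖ ≤ b} =
      (fun q : ℝ × ℝ => (q.1 : ℂ) * Complex.exp (q.2 * Complex.I)) '' (Icc a b ×ˢ univ) := by
    ext w
    constructor
    · rintro ⟨h1, h2⟩
      refine ⟨(‖w‖, Complex.arg w), ⟨⟨h1, h2⟩, mem_univ _⟩, ?_⟩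
      simp only
      exact Complex.norm_mul_exp_arg_mul_I w
    · rintro ⟨⟨r, θ⟩, ⟨⟨hr1, hr2⟩, -⟩, rfl⟩
      have hr : 0 ≤ r := ha.trans hr1
      have : ‖(r : ℂ) * Complex.exp (θ * Complex.I)‖ = r := by
        rw [norm_mul, Complex.norm_exp_ofReal_mul_I, mul_one, Complex.norm_real, Real.norm_eq_abs,
          abs_of_nonneg hr]
      simp only [mem_setOf_eq, this]
      exact ⟨hr1, hr2⟩
  rw [himage]
  refine (isPreconnected_Icc.prod isPreconnected_univ).image _ (Continuous.continuousOn ?_)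
  fun_prop

/-! ### A Jordan loop around a boundary point -/

/-- A Jordan loop surrounding a boundary point of a Jordan domain leaves the closed domain
somewhere (the exterior is connected, unbounded and accumulates at the boundary point). [folklore] -/
theorem exists_param_not_mem_closure (J : JordanDomain) {Γ : ℝ → ℂ} (hΓ : IsJordanLoop Γ) {p : ℂ}
    (hp : p ∈ frontier J.carrier) (hin : p ∈ IsJordanLoop.inside Γ) :
    ∃ t₀, Γ t₀ ∉ closure J.carrier := by
  by_contra h
  push Not at h
  have hsub : (closure J.carrier)ᶜ ⊆ (range Γ)ᶜ := by
    rintro w hw ⟨t, rfl⟩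
    exact hw (h t)
  have hE : (closure J.carrier)ᶜ ⊆ IsJordanLoop.outside Γ := by
    rw [← J.outside_boundary_eq_compl_closure] at hsub ⊢
    exact IsJordanLoop.subset_outside_of_isPreconnected J.isJordanLoop_boundary.isPreconnected_outside
      hsub J.isJordanLoop_boundary.not_isBounded_outside
  -- `p` lies in the closure of the exterior
  have hpcl : p ∈ closure (closure J.carrier)ᶜ := by
    have : p ∈ frontier (IsJordanLoop.outside J.boundary) := by
      rw [J.isJordanLoop_boundary.frontier_outside, J.range_boundary]; exact hp
    rw [J.outside_boundary_eq_compl_closure] at this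
    exact frontier_subset_closure this
  -- a point of the exterior inside `Γ`
  obtain ⟨r, hr, hball⟩ := Metric.isOpen_iff.1 hΓ.isOpen_inside p hin
  obtain ⟨w, hwE, hw⟩ := Metric.mem_closure_iff.1 hpcl r hr
  exact Set.disjoint_left.1 IsJordanLoop.disjoint_inside_outside (hball (mem_ball'.2 hw)) (hE hwE)

/-- Points farther from `p` than the whole loop are outside it. [folklore] -/
theorem mem_outside_of_lt_dist {Γ : ℝ → ℂ} {p : ℂ} {ρ : ℝ} (hρ : 0 ≤ ρ)
    (hΓ : ∀ t, dist (Γ t) p < ρ) {w : ℂ} (hw : ρ < dist w p) : w ∈ IsJordanLoop.outside Γ := by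
  set A : Set ℂ := (Homeomorph.addRight p) '' {z : ℂ | ρ < ‖z‖} with hA
  have hAeq : A = {w : ℂ | ρ < dist w p} := by
    ext w
    simp only [hA, mem_image, mem_setOf_eq, Homeomorph.coe_addRight]
    constructor
    · rintro ⟨z, hz, rfl⟩
      rwa [dist_eq_norm, add_sub_cancel_right]
    · intro hw
      exact ⟨w - p, by rwa [dist_eq_norm] at hw, sub_add_cancel w p⟩
  have hApre : IsPreconnected A :=
    ((isConnected_setOf_lt_norm hρ).image _ (Homeomorph.addRight p).continuous.continuousOn).isPreconnected
  have hAunb : ¬ Bornology.IsBounded A :=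
    (Homeomorph.addRight p).not_isBounded_image (not_isBounded_setOf_lt_norm ρ)
  have hAΓ : A ⊆ (range Γ)ᶜ := by
    rw [hAeq]
    rintro w hw' ⟨t, rfl⟩
    exact lt_asymm hw' (hΓ t)
  have hsub := IsJordanLoop.subset_outside_of_isPreconnected hApre hAΓ hAunb
  exact hsub (by rw [hAeq]; exact hw)

/-! ### Paths along parametrised curves -/

/-- The arc `s ↦ Γ (u + s (v - u))` of a parametrised curve as a `Path` from `Γ u` to `Γ v`
(`u < v`); its range is `Γ '' [u, v]`. [folklore] -/
theorem exists_path_range_eq_image {Γ : ℝ → ℂ} (hΓ : Continuous Γ) {u v : ℝ} (huv : u < v) :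
    ∃ π : Path (Γ u) (Γ v), range π = Γ '' Icc u v := by
  have hvu : 0 < v - u := sub_pos.2 huv
  let π : Path (Γ u) (Γ v) :=
    { toFun := fun s => Γ (u + (s : ℝ) * (v - u))
      continuous_toFun := by fun_prop
      source' := by simp
      target' := by simp }
  refine ⟨π, ?_⟩
  ext w
  constructor
  · rintro ⟨s, rfl⟩
    exact ⟨u + (s : ℝ) * (v - u), ⟨by nlinarith [s.2.1], by nlinarith [s.2.2]⟩, rfl⟩
  · rintro ⟨x, hx, rfl⟩
    refine ⟨⟨(x - u) / (v - u), div_nonneg (by linarith [hx.1]) hvu.le,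
      (div_le_one hvu).2 (by linarith [hx.2])⟩, ?_⟩
    show Γ (u + (x - u) / (v - u) * (v - u)) = Γ x
    rw [div_mul_cancel₀ _ hvu.ne', add_sub_cancel]

/-- A sub-path of `γ` between two of its times (in either order). [folklore] -/
theorem exists_subpath {x y : ℂ} (γ : Path x y) (t₀ t₁ : unitInterval) :
    ∃ (a b : ℂ) (γ' : Path a b), a = γ t₀ ∧ b = γ t₁ ∧ range γ' ⊆ range γ := by
  rcases le_total (t₀ : ℝ) t₁ with h | h
  · refine ⟨_, _, γ.truncateOfLE h, γ.extend_extends' t₀, γ.extend_extends' t₁, ?_⟩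
    exact Path.truncate_range γ
  · refine ⟨_, _, (γ.truncateOfLE h).symm, γ.extend_extends' t₀, γ.extend_extends' t₁, ?_⟩
    rw [Path.symm_range]
    exact Path.truncate_range γ

end Literature.Topology.PlaneTopology
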